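/-
Copyright (c) 2026 the pub-hodgecm-mathlib formalisation cell (harness21).  Prover seat hodgecm-mathlib-LH4-p11 (g2), req620 Track A «(D-RAM) FOUR-FRAME» squad
(unit U3_Laws, (R-17) «NI2 ⊕ MS», MS ROAD A Stage A; brick (O2c) «THE ORBIT COUNT», generic engine: the per-orbit fibre identity (O2b) summed over `𝓛₀(T)`;
MS first-seat lineage LH4-p11 (g0) `MS-ROAD-A-BRICKS.v2` step (3) = (3c-iii) (O) = (O1) + (O2a) + (O2b) + (O2c); acting MS first seat LH4-p10 (g2) MS LEDGER v4
«(O2c) assembly = p11 lineage»; dealer LH4-plan (g11)).  2026-09-04.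
-/
import Summits.HodgeConjecture.HodgeConjecture.Theorems.F0P3cDyRamDiagonalUnitTorusOrbit   -- ★ (O1) p855595 (LH4-p09 (g2)): `ncard_unitTorus_orbit_eq_relIndex_unitStabilizer` (orbit–stabiliser); brings ★ DEFS LEAF p855572, ★ J′, ★ L∕K(a)
import Summits.HodgeConjecture.HodgeConjecture.Theorems.F0P3cDyRamDiagonalPairReindex     -- ★ (O2a) p855745 (LH4-p04 (g2)): `sum_ncard_fixed_vertices_eq_finsum_ncard_pairs`, `mapGL_mapGL_diagGLUnits_eq_iff`; brings ★ `𝓛₀(T)` finite (LH4-p12), ★ H p855247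
import HarnessLib

/-!
# Crux `H413`, line LH4 «(D-RAM) FOUR-FRAME» road — unit U3_Laws (iii), MS ROAD A Stage A, brick (O2c): THE ORBIT COUNT, GENERIC ENGINE —
# averaging a finite sum over the unit-torus orbits of `𝓛₀(T)` and cashing a per-orbit fibre identity into `8 · Σᶠ_{M₀ ∈ 𝓛₀(T), P} 1∕[𝒰 : S_F(M₀)]`

Cell `hodgecm-mathlib` (D-0151), FLOOR 0, crux item H413 = `stmt-HodgeConjecture-24833`, route of record `HCCMUnconditional`; squad F0∕P3c∕LH4 (req618∕req620); registered stub served: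
`F0P3cDyRamFourFrameU3.stub_U3_stableModelSum` (MS; tree `Cruxes/H413/Lines/F0_P3c_DyRamFourFrame_U3_Laws.lean` :109), through which `stub_U3_stableLaw_RP ∕ _RU` are PAID by
composition (U3 ED. 4–7, ★ p855240).  THEOREMS ONLY (no `def`, no instance, no notation, no `sorry`, default heartbeats); lane `--supports stmt-HodgeConjecture-24833 --as helper`
(count-neutral).

THE MATHEMATICS (LH4-p10 MEMO-stableLaw-finite v1 §2 (3) ∕ v2 §0; LH4-p11 (g0) BRICKS v2 (O)).  Let `X = 𝓛₀(T)` be the finite set of normalised `T`-stable lattices (`T = diag(s)`,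
`s` pairwise-distinct units, finite residue field: ★ LH4-p12), acted on by the unit torus `𝒯 = (𝒪^×)³` through `u • M := diag(u)·M` (`T`-stability, `latt`-ness and normalisation
ride along: ★ (O2a) `mapGL_mapGL_diagGLUnits_eq_iff`, ★ `mapGL_latt`, ★ J′), with orbits `𝒯·M₀ ⊆ X` of size `#(𝒯·M₀) = [𝒯 : S̃(M₀)]` (★ (O1)).  For ANY `f : X → ℚ`,
AVERAGING OVER ORBITS gives `Σ_{x ∈ X} f(x) = Σ_{x ∈ X} (Σ_{y ∈ 𝒯·x} f(y)) ∕ #(𝒯·x)` (§1, pure double counting: `y ∈ 𝒯·x ⟺ 𝒯·y = 𝒯·x`, each `y` is counted `#(𝒯·y)` times with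
weight `1∕#(𝒯·y)`).  Hence a PER-ORBIT FIBRE IDENTITY of the shape (O2b) proves — `(Σᶠ_{M ∈ 𝒯·M₀} F(M)) · [𝒰 : S_F(M₀)] = 8 · [𝒯 : S̃(M₀)]` when `P(M₀)`, and `Σᶠ_{M ∈ 𝒯·M₀} F(M) = 0`
otherwise — cashes out as `Σᶠ_{M₀ ∈ X} F(M₀) = 8 · Σᶠ_{M₀ ∈ X, P(M₀)} 1∕[𝒰 : S_F(M₀)] = 8 · Σᶠ_{M₀ ∈ X, P} stabiliserWeight σ M₀` (§3; the indices are non-zero because the orbit is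
finite and non-empty, §2: `[𝒯 : S̃(M₀)] = #(𝒯·M₀) ≥ 1` and `[𝒰 : S_F(M₀)] ≠ 0` from `𝒰 ≤ 𝒯`, `Subgroup.relIndex_eq_zero_of_le_right`).  With ★ (O2a) (the `T`-fixed type-`t` vertices
of the eight forms `diag(c^{e})` re-indexed as pairs over `X`) and `F(M) := #{(e, b) : diag(ϖ^{b})·M type-t for diag(c^{e})}` this is (O2c) MODULO (O2b) (§4, Iverson form of the
hypothesis exactly as (O2b) PART 4 `finsum_ncard_fibre_mul_relIndex_eq_of_mem_normalisedStableLattices{,_zero}` states it — LH4-p14 (g2)); the predicate `P` is free (at MS: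
`P(M₀) = ∃ D₁ σ-fixed non-degenerate, M₀ type-tv for diag D₁`, i.e. ★ `IsDualisableLattice` at `tv = 0`), so the SAME engine serves both vertex types and the type-2 twins.
Downstream: the (O2c) head proper (`… = 8 · Σᶠ_{M₀ ∈ X, polarisable_tv} stabiliserWeight σ M₀`, a one-line application of §4 to (O2b) PART 4 once ★), then Stage B (B10∕B10₂:
`Σᶠ_{X, polarisable_tv} stabiliserWeight = [k]_q`) and the U3 composition of `stub_U3_stableModelSum`.

WHAT IS PROVED (generic valued field `K` with `Valued K ℤᵐ⁰`; §1 for any type; §2 generic `N`; §3–§4 at `N = 3` with `[Finite 𝓀[K]]`).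
* §1 `finsum_mem_eq_finsum_mem_div_ncard_orbit` — averaging over the blocks of a finite set covered by «orbits» (`x ∈ orb x`, `y ∈ orb x → orb y = orb x`, `orb x ⊆ X`).
* §2 `mem_unitTorus_orbit_self`, `unitTorus_orbit_eq_of_mem`, `unitTorus_orbit_subset_normalisedStableLattices` (`T` diagonal), `relIndex_unitStabilizer_ne_zero_of_finite`,
  `relIndex_fixedUnitStabilizer_ne_zero_of_finite` — the unit-torus orbit is a block system on `𝓛₀(T)`; a finite orbit forces `[𝒯 : S̃(M₀)] ≠ 0` and `[𝒰 : S_F(M₀)] ≠ 0`.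
* §3 `cast_finsum_mem_eq_eight_mul_finsum_stabiliserWeight` — THE ENGINE: a per-orbit identity `(Σᶠ_{𝒯·M₀} F)·[𝒰 : S_F(M₀)] = 8·[𝒯 : S̃(M₀)]` on `P`, `Σᶠ_{𝒯·M₀} F = 0` off `P`, for
  ANY `F : _ → ℕ`, `P : _ → Prop`, gives `↑(Σᶠ_{M₀ ∈ 𝓛₀(T)} F M₀) = 8 · Σᶠ_{M₀ ∈ 𝓛₀(T) ∧ P} stabiliserWeight σ M₀` over `ℚ`.
* §4 `sum_ncard_fixed_vertices_eq_eight_mul_finsum_stabiliserWeight_of_fibre_identity` — (O2c) MODULO (O2b): the left-hand side of MS :109 (`Σ_e #{M : type-t for diag(c^{e}),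
  T·M = M}`, cast to `ℚ`) equals `8 · Σᶠ_{M₀ ∈ 𝓛₀(T), P} stabiliserWeight σ M₀` as soon as the (O2b) identity holds in Iverson form at every `M₀ ∈ 𝓛₀(T)`.
HONEST LABEL.  Count-neutral (`--supports`); nothing printed is asserted; (MS) stays a PROVER TARGET (empirical census law); `HC_CM` is proved only modulo the 7 printed citations
(2 remaining named inputs: hLiu418 = `stmt-HodgeConjecture-24832`, h413 = `stmt-HodgeConjecture-24833`) until rung 0 closes.

## References
* [Kottwitz1986BaseChangeUnits] R. E. Kottwitz, *Base change for unit elements of Hecke algebras*, Compositio Math. 60 (1986), §1 pp. 240–241 (orbital integrals of units as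
  lattice counts modulo the torus: the sum over lattices modulo `T(F)` weighted by stabiliser indices).
* [Rogawski1990] J. D. Rogawski, *Automorphic Representations of Unitary Groups in Three Variables*, Ann. of Math. Stud. 123 (1990), §4.9 Prop. 4.9.1 (a) p. 55.
* [Serre1980Trees] J.-P. Serre, *Trees*, Springer (1980), Ch. II §1.1 (lattices `g·𝒪^N` and the diagonal action).
-/

set_option autoImplicit false

noncomputable section

namespace Summit.HodgeConjecture.HodgeConjecture.Cruxes.H413.F0P3cDyRamDiagonalOrbitAveraging

open Matrix
open Literature.NumberTheory.Automorphic Literature.NumberTheory.Automorphic.HermitianLattice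
open Literature.NumberTheory.Automorphic.UnitaryLatticeTree
open Summit.HodgeConjecture.HodgeConjecture.Cruxes.H413.F0P3cDyRamDiagonalTorusDefs
open Summit.HodgeConjecture.HodgeConjecture.Cruxes.H413.F0P3cDyRamDiagonalUnitTorusOrbit
open Summit.HodgeConjecture.HodgeConjecture.Cruxes.H413.F0P3cDyRamDiagonalPairReindex
open scoped Valued WithZero Matrix MatrixGroups

/-! ## §1  Averaging a finite sum over the orbits of a partition -/

/-- **AVERAGING OVER ORBITS** (pure finite double counting).  Let `X` be a finite set and `orb : α → Set α` a block system on `X`: `orb x ⊆ X`, `x ∈ orb x`, and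
`y ∈ orb x → orb y = orb x` (so «`y ∈ orb x`» is an equivalence relation on `X` with classes `orb x`).  Then for every `f : α → ℚ`:
`Σᶠ_{x ∈ X} f x = Σᶠ_{x ∈ X} (Σᶠ_{y ∈ orb x} f y) ∕ #(orb x)` — each `y` is counted once for every `x` of its block, `#(orb y)` times, with weight `1∕#(orb y)`.  This is the
book-keeping behind «sum over lattices = sum over orbits of (orbit sum)», written without choosing orbit representatives. [cite: Kottwitz1986BaseChangeUnits, §1 pp. 240–241] -/
theorem finsum_mem_eq_finsum_mem_div_ncard_orbit {α : Type*} {X : Set α} (hX : X.Finite) (orb : α → Set α)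
    (hsub : ∀ x ∈ X, orb x ⊆ X) (hrefl : ∀ x ∈ X, x ∈ orb x) (horb : ∀ x ∈ X, ∀ y ∈ orb x, orb y = orb x) (f : α → ℚ) :
    ∑ᶠ x ∈ X, f x = ∑ᶠ x ∈ X, (∑ᶠ y ∈ orb x, f y) / ((orb x).ncard : ℚ) := by
  classical
  set S := hX.toFinset with hS
  have hmemS : ∀ {x}, x ∈ S ↔ x ∈ X := fun {x} => hX.mem_toFinset
  -- the orbit of `x ∈ X` as a sub-`Finset` of `S`
  have horbS : ∀ x ∈ X, orb x = ↑(S.filter fun y => y ∈ orb x) := by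
    intro x hx
    ext y
    simp only [Finset.coe_filter, Set.mem_setOf_eq, hmemS]
    exact ⟨fun h => ⟨hsub x hx h, h⟩, fun h => h.2⟩
  have hinner : ∀ x ∈ X, (∑ᶠ y ∈ orb x, f y) / ((orb x).ncard : ℚ) =
      ∑ y ∈ S, if y ∈ orb x then f y / ((S.filter fun y => y ∈ orb x).card : ℚ) else 0 := by
    intro x hx
    have h1 : ∑ᶠ y ∈ orb x, f y = ∑ y ∈ S.filter (fun y => y ∈ orb x), f y := by
      rw [← finsum_mem_coe_finset]
      exact finsum_mem_congr (horbS x hx) fun _ _ => rfl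
    have h2 : ((orb x).ncard : ℚ) = ((S.filter fun y => y ∈ orb x).card : ℚ) := by
      conv_lhs => rw [horbS x hx, Set.ncard_coe_finset]
    rw [h1, h2, Finset.sum_div, Finset.sum_filter]
  rw [finsum_mem_eq_finite_toFinset_sum _ hX, finsum_mem_eq_finite_toFinset_sum _ hX, ← hS]
  rw [Finset.sum_congr rfl fun x hx => hinner x (hmemS.1 hx), Finset.sum_comm]
  refine Finset.sum_congr rfl fun y hy => ?_
  have hyX : y ∈ X := hmemS.1 hy
  -- in the inner sum only the `x` of the orbit of `y` contribute, each the same amount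
  have hsame : ∀ x ∈ S, (if y ∈ orb x then f y / ((S.filter fun y' => y' ∈ orb x).card : ℚ) else 0) =
      if x ∈ orb y then f y / ((S.filter fun y' => y' ∈ orb y).card : ℚ) else 0 := by
    intro x hx
    have hxX : x ∈ X := hmemS.1 hx
    by_cases hyx : y ∈ orb x
    · have he : orb y = orb x := horb x hxX y hyx
      have hxy : x ∈ orb y := he ▸ hrefl x hxX
      rw [if_pos hyx, if_pos hxy, he]
    · have hxy : x ∉ orb y := fun h => hyx ((horb y hyX x h) ▸ hrefl y hyX)
      rw [if_neg hyx, if_neg hxy]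
  rw [Finset.sum_congr rfl hsame, ← Finset.sum_filter, Finset.sum_const, nsmul_eq_mul]
  have hcard : ((S.filter fun y' => y' ∈ orb y).card : ℚ) ≠ 0 := by
    rw [Nat.cast_ne_zero]
    exact Finset.card_ne_zero.2 ⟨y, Finset.mem_filter.2 ⟨hy, hrefl y hyX⟩⟩
  field_simp

/-! ## §2  The unit-torus orbit of a lattice: reflexive, orbits of members coincide, stays inside `𝓛₀(T)`, has positive index -/

variable {K : Type*} [Field K] [Valued K ℤᵐ⁰] {N : ℕ}

/-- `M₀` lies in its own unit-torus orbit `𝒯·M₀ = {diag(u)·M₀ : u ∈ 𝒯}` (`u = 1`, ★ `mapGL_one`). [cite: Serre1980Trees, II §1.1] -/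
theorem mem_unitTorus_orbit_self (M₀ : Submodule 𝒪[K] (Fin N → K)) :
    M₀ ∈ {M : Submodule 𝒪[K] (Fin N → K) | ∃ u ∈ unitTorus K N, M = mapGL (diagGLUnits u) M₀} :=
  ⟨1, one_mem _, by rw [map_one, mapGL_one]⟩

/-- **ORBITS OF ORBIT MEMBERS COINCIDE**: if `M₁ = diag(u₁)·M₀` with `u₁ ∈ 𝒯` then `𝒯·M₁ = 𝒯·M₀` (`𝒯` is a group: `diag(u)·diag(u₁)·M₀ = diag(u u₁)·M₀` and
`diag(u u₁⁻¹)·diag(u₁)·M₀ = diag(u)·M₀`, ★ `mapGL_mul` ∕ `mapGL_inv_mapGL`). [cite: Serre1980Trees, II §1.1] -/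
theorem unitTorus_orbit_eq_of_mem {M₀ M₁ : Submodule 𝒪[K] (Fin N → K)}
    (h : M₁ ∈ {M : Submodule 𝒪[K] (Fin N → K) | ∃ u ∈ unitTorus K N, M = mapGL (diagGLUnits u) M₀}) :
    {M : Submodule 𝒪[K] (Fin N → K) | ∃ u ∈ unitTorus K N, M = mapGL (diagGLUnits u) M₁} =
      {M : Submodule 𝒪[K] (Fin N → K) | ∃ u ∈ unitTorus K N, M = mapGL (diagGLUnits u) M₀} := by
  obtain ⟨u₁, hu₁, rfl⟩ := h
  ext M
  simp only [Set.mem_setOf_eq]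
  constructor
  · rintro ⟨u, hu, rfl⟩
    exact ⟨u * u₁, mul_mem hu hu₁, by rw [map_mul, mapGL_mul]⟩
  · rintro ⟨u, hu, rfl⟩
    refine ⟨u * u₁⁻¹, mul_mem hu (inv_mem hu₁), ?_⟩
    rw [map_mul, mapGL_mul, map_inv, mapGL_inv_mapGL]

/-- **THE UNIT-TORUS ORBIT OF A MEMBER OF `𝓛₀(T)` STAYS IN `𝓛₀(T)`** (`T = diag(s)` diagonal, any `N`): `diag(u)·latt g = latt (diag(u) g)` (★ `mapGL_latt`), `T`-stability
rides along because diagonal matrices commute (★ (O2a) `mapGL_mapGL_diagGLUnits_eq_iff`), and normalisation is preserved exactly by unit diagonal translates (★ J′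
`forall_normalisedAt_mapGL_diagonal_latt_iff`).  (The same three lines as in (O2b) PART 4's finiteness lemma, isolated for the orbit count.) [cite: Kottwitz1986BaseChangeUnits, §1 pp. 240–241]
[cite: Serre1980Trees, II §1.1] -/
theorem unitTorus_orbit_subset_normalisedStableLattices {s : Fin N → K} (T : GL (Fin N) K)
    (hT : (T : Matrix (Fin N) (Fin N) K) = Matrix.diagonal s) {M₀ : Submodule 𝒪[K] (Fin N → K)}
    (hM₀ : M₀ ∈ normalisedStableLattices T) :
    {M : Submodule 𝒪[K] (Fin N → K) | ∃ u ∈ unitTorus K N, M = mapGL (diagGLUnits u) M₀} ⊆ normalisedStableLattices T := by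
  obtain ⟨⟨g, rfl⟩, hTM₀, hnorm⟩ := hM₀
  rintro M ⟨u, hu, rfl⟩
  refine ⟨⟨diagGLUnits u * g, by rw [mapGL_latt]⟩, (mapGL_mapGL_diagGLUnits_eq_iff u T hT _).2 hTM₀, ?_⟩
  exact (Summit.HodgeConjecture.HodgeConjecture.Cruxes.H413.F0P3cDyRamDiagonalNormalisedOrbit.forall_normalisedAt_mapGL_diagonal_latt_iff g
    (fun i => (u i : K)) (diagGLUnits u) (coe_diagGLUnits u) hnorm).2 ((mem_unitTorus_iff u).1 hu)

/-- **A FINITE ORBIT HAS POSITIVE INDEX `[𝒯 : S̃(M₀)]`**: by ★ (O1) `ncard_unitTorus_orbit_eq_relIndex_unitStabilizer` the index is the cardinality of the orbit `𝒯·M₀`,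
which is finite by hypothesis and non-empty (`M₀ ∈ 𝒯·M₀`), hence `≠ 0`. [cite: Kottwitz1986BaseChangeUnits, §1 pp. 240–241] -/
theorem relIndex_unitStabilizer_ne_zero_of_finite {M₀ : Submodule 𝒪[K] (Fin N → K)}
    (hfin : {M : Submodule 𝒪[K] (Fin N → K) | ∃ u ∈ unitTorus K N, M = mapGL (diagGLUnits u) M₀}.Finite) :
    (unitStabilizer M₀).relIndex (unitTorus K N) ≠ 0 := by
  rw [← ncard_unitTorus_orbit_eq_relIndex_unitStabilizer]
  exact ((Set.ncard_pos hfin).2 ⟨M₀, mem_unitTorus_orbit_self M₀⟩).ne'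

/-- **… AND POSITIVE INDEX `[𝒰 : S_F(M₀)]`** (`𝒰 = fixedUnitTorus σ N ≤ 𝒯`): `S_F(M₀) = latticeStabilizer M₀ ⊓ 𝒰` and `S̃(M₀) = latticeStabilizer M₀ ⊓ 𝒯`, so both indices
are relative indices of the SAME subgroup `latticeStabilizer M₀` (`Subgroup.inf_relIndex_right`), and a relative index that vanishes in the smaller group `𝒰` vanishes in `𝒯`
(`Subgroup.relIndex_eq_zero_of_le_right`) — contradicting `relIndex_unitStabilizer_ne_zero_of_finite`.  So the weight `stabiliserWeight σ M₀ = 1∕[𝒰 : S_F(M₀)]` of every member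
of a finite orbit is a genuine inverse. [cite: Kottwitz1986BaseChangeUnits, §1 pp. 240–241] [cite: Rogawski1990, §4.9 Prop. 4.9.1 (a) p. 55] -/
theorem relIndex_fixedUnitStabilizer_ne_zero_of_finite (σ : K →+* K) {M₀ : Submodule 𝒪[K] (Fin N → K)}
    (hfin : {M : Submodule 𝒪[K] (Fin N → K) | ∃ u ∈ unitTorus K N, M = mapGL (diagGLUnits u) M₀}.Finite) :
    (fixedUnitStabilizer σ M₀).relIndex (fixedUnitTorus σ N) ≠ 0 := by
  intro h
  apply relIndex_unitStabilizer_ne_zero_of_finite hfin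
  rw [F0P3cDyRamDiagonalTorusDefs.unitStabilizer, Subgroup.inf_relIndex_right]
  rw [F0P3cDyRamDiagonalTorusDefs.fixedUnitStabilizer, Subgroup.inf_relIndex_right] at h
  exact Subgroup.relIndex_eq_zero_of_le_right (show fixedUnitTorus σ N ≤ unitTorus K N from inf_le_left) h

/-! ## §3  The orbit count: a per-orbit fibre identity summed over `𝓛₀(T)` -/

/-- **THE ORBIT-COUNT ENGINE.**  `T = diag(s)` with `s` pairwise-distinct units, finite residue field (so `𝓛₀(T) = normalisedStableLattices T` is finite, ★ LH4-p12), any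
`σ`, any `F : lattices → ℕ` and any predicate `P`.  IF at every `M₀ ∈ 𝓛₀(T)`: `P M₀ ⇒ (Σᶠ_{M ∈ 𝒯·M₀} F M) · [𝒰 : S_F(M₀)] = 8 · [𝒯 : S̃(M₀)]` and `¬ P M₀ ⇒ Σᶠ_{M ∈ 𝒯·M₀} F M = 0`,
THEN `↑(Σᶠ_{M₀ ∈ 𝓛₀(T)} F M₀) = 8 · Σᶠ_{M₀ ∈ {M ∈ 𝓛₀(T) | P M}} stabiliserWeight σ M₀` in `ℚ`.  Proof: §1 averaging with `orb = 𝒯·(·)` (a block system on `𝓛₀(T)` by §2), then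
orbit by orbit `(Σᶠ_{𝒯·M₀} F) ∕ #(𝒯·M₀) = 8·[𝒯 : S̃]∕([𝒰 : S_F]·[𝒯 : S̃]) = 8 · stabiliserWeight σ M₀` on `P` (★ (O1) `#(𝒯·M₀) = [𝒯 : S̃(M₀)]`, both indices `≠ 0` by §2) and `0` off `P`;
finally `Σᶠ_{𝓛₀} (if P then 8·w else 0) = 8 · Σᶠ_{𝓛₀ ∩ P} w`.  No orbit-invariance of `P` is needed (it is evaluated at the base point of each averaged term only).
[cite: Kottwitz1986BaseChangeUnits, §1 pp. 240–241] [cite: Rogawski1990, §4.9 Prop. 4.9.1 (a) p. 55] -/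
theorem cast_finsum_mem_eq_eight_mul_finsum_stabiliserWeight [Finite 𝓀[K]]
    {ϖ : K} (hϖ : Valued.v ϖ = WithZero.exp (-1 : ℤ)) {s : Fin 3 → K} (hs : ∀ i, Valued.v (s i) = 1) (hreg : ∀ i j, i ≠ j → s i ≠ s j)
    (T : GL (Fin 3) K) (hT : (T : Matrix (Fin 3) (Fin 3) K) = Matrix.diagonal s) (σ : K →+* K)
    (F : Submodule 𝒪[K] (Fin 3 → K) → ℕ) (P : Submodule 𝒪[K] (Fin 3 → K) → Prop)
    (hpos : ∀ M₀ ∈ normalisedStableLattices T, P M₀ →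
      (∑ᶠ M ∈ {M : Submodule 𝒪[K] (Fin 3 → K) | ∃ u ∈ unitTorus K 3, M = mapGL (diagGLUnits u) M₀}, F M) *
          (fixedUnitStabilizer σ M₀).relIndex (fixedUnitTorus σ 3) = 8 * (unitStabilizer M₀).relIndex (unitTorus K 3))
    (hzero : ∀ M₀ ∈ normalisedStableLattices T, ¬ P M₀ →
      ∑ᶠ M ∈ {M : Submodule 𝒪[K] (Fin 3 → K) | ∃ u ∈ unitTorus K 3, M = mapGL (diagGLUnits u) M₀}, F M = 0) :
    (((∑ᶠ M₀ ∈ normalisedStableLattices T, F M₀ : ℕ) : ℚ)) =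
      8 * ∑ᶠ M₀ ∈ {M : Submodule 𝒪[K] (Fin 3 → K) | M ∈ normalisedStableLattices T ∧ P M}, stabiliserWeight σ M₀ := by
  classical
  have h𝓛 : (normalisedStableLattices T).Finite :=
    F0P3cDyRamDiagonalStableLatticesFinite.finite_setOf_normalised_diagonal_fixed_latt hϖ s hs hreg T hT
  have hsub : ∀ M₀ ∈ normalisedStableLattices T,
      {M : Submodule 𝒪[K] (Fin 3 → K) | ∃ u ∈ unitTorus K 3, M = mapGL (diagGLUnits u) M₀} ⊆ normalisedStableLattices T :=
    fun M₀ hM₀ => unitTorus_orbit_subset_normalisedStableLattices T hT hM₀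
  have hfinO : ∀ M₀ ∈ normalisedStableLattices T,
      {M : Submodule 𝒪[K] (Fin 3 → K) | ∃ u ∈ unitTorus K 3, M = mapGL (diagGLUnits u) M₀}.Finite :=
    fun M₀ hM₀ => h𝓛.subset (hsub M₀ hM₀)
  have hcast : (((∑ᶠ M₀ ∈ normalisedStableLattices T, F M₀ : ℕ) : ℚ)) = ∑ᶠ M₀ ∈ normalisedStableLattices T, (F M₀ : ℚ) := by
    rw [finsum_mem_eq_finite_toFinset_sum _ h𝓛, finsum_mem_eq_finite_toFinset_sum _ h𝓛, Nat.cast_sum]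
  rw [hcast, finsum_mem_eq_finsum_mem_div_ncard_orbit h𝓛
    (fun M₀ => {M : Submodule 𝒪[K] (Fin 3 → K) | ∃ u ∈ unitTorus K 3, M = mapGL (diagGLUnits u) M₀}) hsub
    (fun M₀ _ => mem_unitTorus_orbit_self M₀) (fun M₀ _ M hM => unitTorus_orbit_eq_of_mem hM) (fun M => (F M : ℚ))]
  -- evaluate the average over each orbit
  have hterm : ∀ M₀ ∈ normalisedStableLattices T,
      (∑ᶠ M ∈ {M : Submodule 𝒪[K] (Fin 3 → K) | ∃ u ∈ unitTorus K 3, M = mapGL (diagGLUnits u) M₀}, (F M : ℚ)) /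
          (({M : Submodule 𝒪[K] (Fin 3 → K) | ∃ u ∈ unitTorus K 3, M = mapGL (diagGLUnits u) M₀}.ncard : ℕ) : ℚ) =
        if P M₀ then 8 * stabiliserWeight σ M₀ else 0 := by
    intro M₀ hM₀
    have hn0 : (unitStabilizer M₀).relIndex (unitTorus K 3) ≠ 0 := relIndex_unitStabilizer_ne_zero_of_finite (hfinO M₀ hM₀)
    have hi0 : (fixedUnitStabilizer σ M₀).relIndex (fixedUnitTorus σ 3) ≠ 0 :=
      relIndex_fixedUnitStabilizer_ne_zero_of_finite σ (hfinO M₀ hM₀)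
    have hcastO : ∑ᶠ M ∈ {M : Submodule 𝒪[K] (Fin 3 → K) | ∃ u ∈ unitTorus K 3, M = mapGL (diagGLUnits u) M₀}, (F M : ℚ) =
        ((∑ᶠ M ∈ {M : Submodule 𝒪[K] (Fin 3 → K) | ∃ u ∈ unitTorus K 3, M = mapGL (diagGLUnits u) M₀}, F M : ℕ) : ℚ) := by
      rw [finsum_mem_eq_finite_toFinset_sum _ (hfinO M₀ hM₀), finsum_mem_eq_finite_toFinset_sum _ (hfinO M₀ hM₀), Nat.cast_sum]
    rw [hcastO, ncard_unitTorus_orbit_eq_relIndex_unitStabilizer]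
    split_ifs with hP
    · have h' : (((∑ᶠ M ∈ {M : Submodule 𝒪[K] (Fin 3 → K) | ∃ u ∈ unitTorus K 3, M = mapGL (diagGLUnits u) M₀}, F M : ℕ) : ℚ)) *
          (((fixedUnitStabilizer σ M₀).relIndex (fixedUnitTorus σ 3) : ℕ) : ℚ) =
            8 * (((unitStabilizer M₀).relIndex (unitTorus K 3) : ℕ) : ℚ) := by
        exact_mod_cast hpos M₀ hM₀ hP
      have hnq : (((unitStabilizer M₀).relIndex (unitTorus K 3) : ℕ) : ℚ) ≠ 0 := Nat.cast_ne_zero.2 hn0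
      have hiq : (((fixedUnitStabilizer σ M₀).relIndex (fixedUnitTorus σ 3) : ℕ) : ℚ) ≠ 0 := Nat.cast_ne_zero.2 hi0
      rw [stabiliserWeight, div_eq_iff hnq, ← mul_right_cancel_iff_of_pos (Nat.cast_pos.2 (Nat.pos_of_ne_zero hi0)), h']
      field_simp
    · rw [hzero M₀ hM₀ hP, Nat.cast_zero, zero_div]
  rw [finsum_mem_congr rfl hterm]
  -- `Σᶠ_{𝓛₀} (if P then 8·w else 0) = 8 · Σᶠ_{𝓛₀ ∩ P} w`
  have hset : {M : Submodule 𝒪[K] (Fin 3 → K) | M ∈ normalisedStableLattices T ∧ P M} = ↑(h𝓛.toFinset.filter P) := by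
    ext M
    simp only [Set.mem_setOf_eq, Finset.coe_filter, Set.Finite.mem_toFinset]
  rw [hset, finsum_mem_coe_finset, finsum_mem_eq_finite_toFinset_sum _ h𝓛, Finset.sum_filter, Finset.mul_sum]
  exact Finset.sum_congr rfl fun M _ => by split_ifs <;> simp

/-! ## §4  (O2c) modulo the per-orbit fibre identity (O2b): the eight-class model sum in `𝓛₀(T)`-weight currency -/

open Classical in
/-- **(O2c) MODULO (O2b) — THE EIGHT-CLASS MODEL SUM IN `𝓛₀(T)`-WEIGHT CURRENCY.**  Over a `ℤᵐ⁰`-valued field with finite residue field, valuation-preserving `σ`, uniformiser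
`ϖ` (`ϖu` the same element as a unit), a unit `c`, a regular unit diagonal `T = diag(s)`, a type `t` and ANY predicate `P` on lattices: if the FIBRE IDENTITY (O2b) holds in
Iverson form at every `M₀ ∈ 𝓛₀(T)` — `(Σᶠ_{M ∈ 𝒯·M₀} #{(e, b) : diag(ϖ^{b})·M type-t for diag(c^{e})}) · [𝒰 : S_F(M₀)] = 8 · [𝒯 : S̃(M₀)] · [P M₀]` (exactly the shape of (O2b) PART 4
`finsum_ncard_fibre_mul_relIndex_eq_of_mem_normalisedStableLattices`, LH4-p14 (g2), with `P M₀ = ∃ D₁ σ-fixed non-degenerate, M₀ type-t for diag D₁`) — then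
`↑(Σ_{e : Fin 3 → Bool} #{M : M type-t for diag(c^{e}), T·M = M}) = 8 · Σᶠ_{M₀ ∈ {M ∈ 𝓛₀(T) | P M}} stabiliserWeight σ M₀` over `ℚ`: the left-hand side is the summand block
of MS :109 token for token; ★ (O2a) re-indexes it as `Σᶠ_{M₀ ∈ 𝓛₀(T)} F(M₀)` and §3 does the rest (off `P` the product vanishing forces `Σᶠ F = 0` because `[𝒰 : S_F(M₀)] ≠ 0`, §2).
[cite: Kottwitz1986BaseChangeUnits, §1 pp. 240–241] [cite: Rogawski1990, §4.9 Prop. 4.9.1 (a) p. 55] [cite: Serre1980Trees, II §1.1] -/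
theorem sum_ncard_fixed_vertices_eq_eight_mul_finsum_stabiliserWeight_of_fibre_identity [Finite 𝓀[K]] {σ : K →+* K}
    (hvσ : ∀ a, Valued.v (σ a) = Valued.v a) {ϖ : K} (hϖ : Valued.v ϖ = WithZero.exp (-1 : ℤ)) (ϖu : Kˣ) (hϖu : (ϖu : K) = ϖ)
    {c : K} (hc : Valued.v c = 1) {s : Fin 3 → K} (hs : ∀ i, Valued.v (s i) = 1) (hreg : ∀ i j, i ≠ j → s i ≠ s j)
    (T : GL (Fin 3) K) (hT : (T : Matrix (Fin 3) (Fin 3) K) = Matrix.diagonal s) (t : ℕ) (P : Submodule 𝒪[K] (Fin 3 → K) → Prop)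
    (hO2b : ∀ M₀ ∈ normalisedStableLattices T,
      (∑ᶠ M ∈ {M : Submodule 𝒪[K] (Fin 3 → K) | ∃ u ∈ unitTorus K 3, M = mapGL (diagGLUnits u) M₀},
          ({p : (Fin 3 → Bool) × (Fin 3 → ℤ) |
            IsVertexLattice σ ϖ (Matrix.diagonal fun i => if p.1 i then c else (1 : K)) t (mapGL (diagGLUnits fun i => ϖu ^ p.2 i) M)} : Set _).ncard)
        * (fixedUnitStabilizer σ M₀).relIndex (fixedUnitTorus σ 3)
        = 8 * (unitStabilizer M₀).relIndex (unitTorus K 3) * (if P M₀ then 1 else 0)) :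
    (((∑ e : Fin 3 → Bool, {M : Submodule 𝒪[K] (Fin 3 → K) |
        IsVertexLattice σ ϖ (Matrix.diagonal fun i => if e i then c else (1 : K)) t M ∧ mapGL T M = M}.ncard : ℕ) : ℚ)) =
      8 * ∑ᶠ M₀ ∈ {M : Submodule 𝒪[K] (Fin 3 → K) | M ∈ normalisedStableLattices T ∧ P M}, stabiliserWeight σ M₀ := by
  have hinj : Function.Injective s := fun i j hij => by
    by_contra h
    exact hreg i j h hij
  rw [sum_ncard_fixed_vertices_eq_finsum_ncard_pairs hvσ hϖ ϖu hϖu hc hs hinj T hT t]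
  have h𝓛 : (normalisedStableLattices T).Finite :=
    F0P3cDyRamDiagonalStableLatticesFinite.finite_setOf_normalised_diagonal_fixed_latt hϖ s hs hreg T hT
  refine cast_finsum_mem_eq_eight_mul_finsum_stabiliserWeight hϖ hs hreg T hT σ _ P (fun M₀ hM₀ hP => ?_) (fun M₀ hM₀ hP => ?_)
  · have h := hO2b M₀ hM₀
    rwa [if_pos hP, mul_one] at h
  · have h := hO2b M₀ hM₀
    rw [if_neg hP, mul_zero] at h
    have hi0 : (fixedUnitStabilizer σ M₀).relIndex (fixedUnitTorus σ 3) ≠ 0 :=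
      relIndex_fixedUnitStabilizer_ne_zero_of_finite σ (h𝓛.subset (unitTorus_orbit_subset_normalisedStableLattices T hT hM₀))
    exact (mul_eq_zero.1 h).resolve_right hi0

/-! ## ED. 2 (append-only; LH4-p11 (g2) RULING 2026-09-04T00:53Z «RE-KEY tv = 2 ON MULTIPLICITY», on LH4-p09 (g2)'s flag that the type-2 polarisations of a glued
lattice with `ρ` even form `q` cosets of `S_F`, not one): §5 the engine and §6 the (O2c) reduction WITH A MULTIPLICITY `m(M₀)` in the per-orbit identity — the one-coset
(`P`-indicator) forms §3–§4 are the case `m = [P]` -/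

/-! ## §5  The orbit-count engine with multiplicity -/

/-- **THE ORBIT-COUNT ENGINE WITH MULTIPLICITY.**  `T = diag(s)` with `s` pairwise-distinct units, finite residue field, any `σ`, any `F : lattices → ℕ` and any
`m : lattices → ℕ`.  IF at every `M₀ ∈ 𝓛₀(T)`: `(Σᶠ_{M ∈ 𝒯·M₀} F M) · [𝒰 : S_F(M₀)] = 8 · [𝒯 : S̃(M₀)] · m(M₀)`, THEN
`↑(Σᶠ_{M₀ ∈ 𝓛₀(T)} F M₀) = 8 · Σᶠ_{M₀ ∈ 𝓛₀(T)} (m M₀ : ℚ) · stabiliserWeight σ M₀` in `ℚ`.  Same proof as §3: §1 averaging over the unit-torus orbits, then orbit by orbit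
`(Σᶠ_{𝒯·M₀} F) ∕ #(𝒯·M₀) = 8·[𝒯:S̃]·m ∕ ([𝒰:S_F]·[𝒯:S̃]) = 8 · m(M₀) · stabiliserWeight σ M₀` (★ (O1), both indices `≠ 0` by §2).  The re-keyed Stage A of the type-2 half
of (MS) runs on this with `m = polarisationCount σ ϖ 2` (★ StrataDefs ED. 3). [cite: Kottwitz1986BaseChangeUnits, §1 pp. 240–241] [cite: Rogawski1990, §4.9 Prop. 4.9.1 (a) p. 55] -/
theorem cast_finsum_mem_eq_eight_mul_finsum_mul_stabiliserWeight [Finite 𝓀[K]]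
    {ϖ : K} (hϖ : Valued.v ϖ = WithZero.exp (-1 : ℤ)) {s : Fin 3 → K} (hs : ∀ i, Valued.v (s i) = 1) (hreg : ∀ i j, i ≠ j → s i ≠ s j)
    (T : GL (Fin 3) K) (hT : (T : Matrix (Fin 3) (Fin 3) K) = Matrix.diagonal s) (σ : K →+* K)
    (F : Submodule 𝒪[K] (Fin 3 → K) → ℕ) (m : Submodule 𝒪[K] (Fin 3 → K) → ℕ)
    (hmult : ∀ M₀ ∈ normalisedStableLattices T,
      (∑ᶠ M ∈ {M : Submodule 𝒪[K] (Fin 3 → K) | ∃ u ∈ unitTorus K 3, M = mapGL (diagGLUnits u) M₀}, F M) *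
          (fixedUnitStabilizer σ M₀).relIndex (fixedUnitTorus σ 3) = 8 * (unitStabilizer M₀).relIndex (unitTorus K 3) * m M₀) :
    (((∑ᶠ M₀ ∈ normalisedStableLattices T, F M₀ : ℕ) : ℚ)) =
      8 * ∑ᶠ M₀ ∈ normalisedStableLattices T, (m M₀ : ℚ) * stabiliserWeight σ M₀ := by
  classical
  have h𝓛 : (normalisedStableLattices T).Finite :=
    F0P3cDyRamDiagonalStableLatticesFinite.finite_setOf_normalised_diagonal_fixed_latt hϖ s hs hreg T hT
  have hsub : ∀ M₀ ∈ normalisedStableLattices T,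
      {M : Submodule 𝒪[K] (Fin 3 → K) | ∃ u ∈ unitTorus K 3, M = mapGL (diagGLUnits u) M₀} ⊆ normalisedStableLattices T :=
    fun M₀ hM₀ => unitTorus_orbit_subset_normalisedStableLattices T hT hM₀
  have hfinO : ∀ M₀ ∈ normalisedStableLattices T,
      {M : Submodule 𝒪[K] (Fin 3 → K) | ∃ u ∈ unitTorus K 3, M = mapGL (diagGLUnits u) M₀}.Finite :=
    fun M₀ hM₀ => h𝓛.subset (hsub M₀ hM₀)
  have hcast : (((∑ᶠ M₀ ∈ normalisedStableLattices T, F M₀ : ℕ) : ℚ)) = ∑ᶠ M₀ ∈ normalisedStableLattices T, (F M₀ : ℚ) := by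
    rw [finsum_mem_eq_finite_toFinset_sum _ h𝓛, finsum_mem_eq_finite_toFinset_sum _ h𝓛, Nat.cast_sum]
  rw [hcast, finsum_mem_eq_finsum_mem_div_ncard_orbit h𝓛
    (fun M₀ => {M : Submodule 𝒪[K] (Fin 3 → K) | ∃ u ∈ unitTorus K 3, M = mapGL (diagGLUnits u) M₀}) hsub
    (fun M₀ _ => mem_unitTorus_orbit_self M₀) (fun M₀ _ M hM => unitTorus_orbit_eq_of_mem hM) (fun M => (F M : ℚ))]
  -- evaluate the average over each orbit
  have hterm : ∀ M₀ ∈ normalisedStableLattices T,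
      (∑ᶠ M ∈ {M : Submodule 𝒪[K] (Fin 3 → K) | ∃ u ∈ unitTorus K 3, M = mapGL (diagGLUnits u) M₀}, (F M : ℚ)) /
          (({M : Submodule 𝒪[K] (Fin 3 → K) | ∃ u ∈ unitTorus K 3, M = mapGL (diagGLUnits u) M₀}.ncard : ℕ) : ℚ) =
        8 * ((m M₀ : ℚ) * stabiliserWeight σ M₀) := by
    intro M₀ hM₀
    have hn0 : (unitStabilizer M₀).relIndex (unitTorus K 3) ≠ 0 := relIndex_unitStabilizer_ne_zero_of_finite (hfinO M₀ hM₀)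
    have hi0 : (fixedUnitStabilizer σ M₀).relIndex (fixedUnitTorus σ 3) ≠ 0 :=
      relIndex_fixedUnitStabilizer_ne_zero_of_finite σ (hfinO M₀ hM₀)
    have hcastO : ∑ᶠ M ∈ {M : Submodule 𝒪[K] (Fin 3 → K) | ∃ u ∈ unitTorus K 3, M = mapGL (diagGLUnits u) M₀}, (F M : ℚ) =
        ((∑ᶠ M ∈ {M : Submodule 𝒪[K] (Fin 3 → K) | ∃ u ∈ unitTorus K 3, M = mapGL (diagGLUnits u) M₀}, F M : ℕ) : ℚ) := by
      rw [finsum_mem_eq_finite_toFinset_sum _ (hfinO M₀ hM₀), finsum_mem_eq_finite_toFinset_sum _ (hfinO M₀ hM₀), Nat.cast_sum]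
    rw [hcastO, ncard_unitTorus_orbit_eq_relIndex_unitStabilizer]
    have h' : (((∑ᶠ M ∈ {M : Submodule 𝒪[K] (Fin 3 → K) | ∃ u ∈ unitTorus K 3, M = mapGL (diagGLUnits u) M₀}, F M : ℕ) : ℚ)) *
        (((fixedUnitStabilizer σ M₀).relIndex (fixedUnitTorus σ 3) : ℕ) : ℚ) =
          8 * (((unitStabilizer M₀).relIndex (unitTorus K 3) : ℕ) : ℚ) * (m M₀ : ℚ) := by
      exact_mod_cast hmult M₀ hM₀
    have hnq : (((unitStabilizer M₀).relIndex (unitTorus K 3) : ℕ) : ℚ) ≠ 0 := Nat.cast_ne_zero.2 hn0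
    have hiq : (((fixedUnitStabilizer σ M₀).relIndex (fixedUnitTorus σ 3) : ℕ) : ℚ) ≠ 0 := Nat.cast_ne_zero.2 hi0
    rw [stabiliserWeight, div_eq_iff hnq, ← mul_right_cancel_iff_of_pos (Nat.cast_pos.2 (Nat.pos_of_ne_zero hi0)), h']
    field_simp
  rw [finsum_mem_congr rfl hterm]
  -- pull out the factor `8`
  rw [finsum_mem_eq_finite_toFinset_sum _ h𝓛, finsum_mem_eq_finite_toFinset_sum _ h𝓛, Finset.mul_sum]

/-! ## §6  (O2c) with multiplicity, modulo the per-orbit fibre identity (O2b) with multiplicity -/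

/-- **(O2c) WITH MULTIPLICITY, MODULO (O2b) WITH MULTIPLICITY.**  Over a `ℤᵐ⁰`-valued field with finite residue field, valuation-preserving `σ`, uniformiser `ϖ = ↑ϖu`, a unit
`c`, a regular unit diagonal `T = diag(s)`, a type `t` and ANY multiplicity `m : lattices → ℕ`: if the FIBRE IDENTITY WITH MULTIPLICITY holds at every `M₀ ∈ 𝓛₀(T)` —
`(Σᶠ_{M ∈ 𝒯·M₀} #{(e, b) : diag(ϖ^{b})·M type-t for diag(c^{e})}) · [𝒰 : S_F(M₀)] = 8 · [𝒯 : S̃(M₀)] · m(M₀)` (the shape (O2b) PART 3∕4 takes once the Iverson bracket is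
replaced by the polarisation count, LH4-p14 (g2)) — then `↑(Σ_{e : Fin 3 → Bool} #{M : M type-t for diag(c^{e}), T·M = M}) = 8 · Σᶠ_{M₀ ∈ 𝓛₀(T)} (m M₀ : ℚ) · stabiliserWeight σ M₀`
over `ℚ` (★ (O2a) re-indexing + §5).  At `m = polarisationCount σ ϖ t` this is the re-keyed Stage A of (MS). [cite: Kottwitz1986BaseChangeUnits, §1 pp. 240–241]
[cite: Rogawski1990, §4.9 Prop. 4.9.1 (a) p. 55] [cite: Serre1980Trees, II §1.1] -/
theorem sum_ncard_fixed_vertices_eq_eight_mul_finsum_mul_stabiliserWeight_of_fibre_identity [Finite 𝓀[K]] {σ : K →+* K}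
    (hvσ : ∀ a, Valued.v (σ a) = Valued.v a) {ϖ : K} (hϖ : Valued.v ϖ = WithZero.exp (-1 : ℤ)) (ϖu : Kˣ) (hϖu : (ϖu : K) = ϖ)
    {c : K} (hc : Valued.v c = 1) {s : Fin 3 → K} (hs : ∀ i, Valued.v (s i) = 1) (hreg : ∀ i j, i ≠ j → s i ≠ s j)
    (T : GL (Fin 3) K) (hT : (T : Matrix (Fin 3) (Fin 3) K) = Matrix.diagonal s) (t : ℕ) (m : Submodule 𝒪[K] (Fin 3 → K) → ℕ)
    (hO2b : ∀ M₀ ∈ normalisedStableLattices T,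
      (∑ᶠ M ∈ {M : Submodule 𝒪[K] (Fin 3 → K) | ∃ u ∈ unitTorus K 3, M = mapGL (diagGLUnits u) M₀},
          ({p : (Fin 3 → Bool) × (Fin 3 → ℤ) |
            IsVertexLattice σ ϖ (Matrix.diagonal fun i => if p.1 i then c else (1 : K)) t (mapGL (diagGLUnits fun i => ϖu ^ p.2 i) M)} : Set _).ncard)
        * (fixedUnitStabilizer σ M₀).relIndex (fixedUnitTorus σ 3)
        = 8 * (unitStabilizer M₀).relIndex (unitTorus K 3) * m M₀) :
    (((∑ e : Fin 3 → Bool, {M : Submodule 𝒪[K] (Fin 3 → K) |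
        IsVertexLattice σ ϖ (Matrix.diagonal fun i => if e i then c else (1 : K)) t M ∧ mapGL T M = M}.ncard : ℕ) : ℚ)) =
      8 * ∑ᶠ M₀ ∈ normalisedStableLattices T, (m M₀ : ℚ) * stabiliserWeight σ M₀ := by
  have hinj : Function.Injective s := fun i j hij => by
    by_contra h
    exact hreg i j h hij
  rw [sum_ncard_fixed_vertices_eq_finsum_ncard_pairs hvσ hϖ ϖu hϖu hc hs hinj T hT t]
  exact cast_finsum_mem_eq_eight_mul_finsum_mul_stabiliserWeight hϖ hs hreg T hT σ _ m hO2b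

end Summit.HodgeConjecture.HodgeConjecture.Cruxes.H413.F0P3cDyRamDiagonalOrbitAveraging

end
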